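import Mathlib
import HarnessLib
import Summits.Ventures.LatticeQCDFlow.Scaling.KernelMarginalSMTP2Chain
import Summits.Ventures.LatticeQCDFlow.Scaling.EliminationFrontComponents

/-!
# LatticeQCDFlow / Scaling — C5 IN EVERY DIMENSION: the exact autoregressive conditional of a
# ferromagnet is strictly TP₂ in — hence READS — every retained site chained to it through the
# integrated block; its context is EXACTLY the fill-neighbourhood

HONEST FRAMING: exact (Metropolis-corrected) sampling algorithms for lattice gauge theory;
figures of merit are autocorrelation/cost numbers at stated couplings and volumes; no
continuum-physics claim.

Venture `LatticeQCDFlow` (cell pub-lqcd), topic `Scaling`, FANOUT row 30 (lean-1, GEN-17) — OUR WORK for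
THEORY-2 §4 (C5 / T2-AF: what an exact autoregressive sampler of a lattice field must represent).
GEN-16/17 typed 'the exact conditional reads its whole fill-neighbourhood' one bond deep
(`AutoregressiveBondFaithful`) and, in ONE dimension, through the integrated block
(`KernelCompositionTP2` → `AutoregressivePathFaithful` → the ring files); `KernelMarginalMTP2` /
`AutoregressiveMonotoneContext` gave the non-strict half in every dimension.  This file closes the loop
in EVERY dimension with the strict-MTP₂-marginal engine of `KernelMarginalSMTP2` / `…Chain`:

* §1 **`pureSq_pairBondWeight_of_edge`** — for the ferromagnetic pair-interaction weight
  `w(x) = ∏_i g_i(x_i)·∏_{e∈E} b_e(x_{src e}, x_{tgt e})` (positive one-body factors, positive TP₂ bonds)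
  an edge joining `i ≠ k` with a STRICTLY TP₂ bond makes the pure `(i, k)`-squares of `w` strict.
* §2 **`pairBondWeight_coordAvg_pureSq_of_chain`** — ANY finite graph (any dimension, any boundary
  condition), positive bounded measurable factors, TP₂ bonds, ANY reference probability measure that is
  not a point mass; block `s`, current site `a` and retained site `j ≠ a` outside `s`, and a chain
  `a, c₁, …, cₙ, j` with `c₁, …, cₙ ∈ s` distinct, consecutive sites distinct and joined by an edge whose
  bond is strictly TP₂ ⇒ `N = A_s w` is STRICTLY TP₂ in `(a, j)` at EVERY configuration:
  `N(z[a↦α][j↦β'])·N(z[a↦α'][j↦β]) < N(z[a↦α'][j↦β'])·N(z[a↦α][j↦β])` (`α < α'`, `β < β'`).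
* §3 **`arConditional_reads_of_pureSq_lt`** (ANY positive bounded measurable weight: ONE strict
  `(a, j)`-square of `A_s w` ⇒ two configurations agreeing off `j` give different conditionals — were it
  blind, the ratio would factor through `a` and `j` separately, the normaliser not reading `a`
  (`coordAvg_update_of_mem`), forcing equality) and **`pairBondWeight_arConditional_reads_of_chain`** —
  HENCE THE EXACT CONDITIONAL `A_s w / A_{insert a s} w` OF SITE `a` READS `j`.
* §4 **`pairBondWeight_arConditional_reads_outer`** / **`pairBondWeight_arConditional_reads_higherAdj`**
  — THE LOWER HALF OF THE CONTEXT BRACKET: on a graph `G` whose every edge carries a strictly TP₂ bond,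
  generating from the top (`s = {u | u < a}`), the exact conditional of `a` READS EVERY vertex of
  `outer G (lowerComp G a) = adj⁺_{elim G}(a)` (GEN-14 `higherAdj_elimGraph_eq_outer_lowerComp`;
  `exists_chain_of_mem_outer`: the path inside the lower component, made simple by `Walk.bypass`, is
  an integrated strictly linked chain).  With GEN-15's upper half `AutoregressiveMarkovContext.arConditional_congr_of_higherAdj`
  (nothing outside `{a} ∪ adj⁺(a)` is read) THE CONTEXT OF THE EXACT AUTOREGRESSIVE CONDITIONAL OF A
  STRICTLY TP₂ FERROMAGNET IS EXACTLY THE FILL-NEIGHBOURHOOD — T2-AF's triangular-footprint bracket is an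
  equality, in every dimension and for every generation order.

READING (value-free): for gradient-`φ⁴` / Gaussian / ferromagnetic `σ`-type targets with strictly TP₂
nearest-neighbour bonds (e.g. `e^{−V(u−t)}` with `V` strictly convex) in ANY dimension, an exact
autoregressive sampler generating site `a` while the block `s` is still to come must read EVERY already
generated site from which a path of future sites leads to `a` — for the raster order on a torus that is
the whole fill-neighbourhood of `a`, however far away; no receptive field smaller than `adj⁺(a)` is
exact, and (GEN-15) none larger is needed.  NOT CLAIMED: gauge theories (plaquette interactions are not
pair bonds — see `AutoregressiveGaugePlaquetteReads` for the 2-d U(1) statement); bonds that are TP₂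
but not strictly (then links may fail); any rate or number of ours.  Elementary over the parents;
nothing is cited as a fact; no `def`; no `sorry`.
-/

noncomputable section

namespace Summit.Ventures.LatticeQCDFlow.Theory2.Autoregressive

open MeasureTheory Function Set
open Summit.Ventures.LatticeQCDFlow.Exactness

variable {κ : Type*} {X : Type*} [LinearOrder X] [MeasurableSpace X]

/-! ## §1–§2 Strictly TP₂ edges; strict TP₂ of the partial average along an integrated chain -/

section PairBond

variable [Fintype κ] [DecidableEq κ] (μ : Measure X) [IsProbabilityMeasure μ]

omit [MeasurableSpace X] in
/-- **A strictly TP₂ edge gives strict pure squares**: for the ferromagnetic pair-interaction weight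
`w(x) = ∏_i g_i(x_i) · ∏_{e ∈ E} b_e(x_{src e}, x_{tgt e})` with POSITIVE one-body factors and POSITIVE
TP₂ bonds, an edge `e ∈ E` joining `i ≠ k` whose bond is STRICTLY TP₂ makes the pure `(i, k)`-squares
of `w` strict (split off the edge; the rest is MTP₂ by `KernelMarginalMTP2`). [ours] -/
theorem pureSq_pairBondWeight_of_edge {η : Type*} (E : Finset η) (src tgt : η → κ)
    (b : η → X → X → ℝ) (g : κ → X → ℝ) (hg0 : ∀ i u, 0 < g i u) (hb0 : ∀ e u v, 0 < b e u v)
    (hb : ∀ e u u' v v', u ≤ u' → v ≤ v' → b e u' v * b e u v' ≤ b e u v * b e u' v')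
    {i k : κ} (hik : i ≠ k) {e : η} (he : e ∈ E)
    (hor : (src e = i ∧ tgt e = k) ∨ (src e = k ∧ tgt e = i))
    (hstrict : ∀ u u' v v', u < u' → v < v' → b e u' v * b e u v' < b e u v * b e u' v')
    (z : κ → X) {α α' β β' : X} (hα : α < α') (hβ : β < β') :
    let w : (κ → X) → ℝ := fun x => (∏ i, g i (x i)) * ∏ e ∈ E, b e (x (src e)) (x (tgt e))
    w (update (update z i α) k β') * w (update (update z i α') k β) <
      w (update (update z i α') k β') * w (update (update z i α) k β) := by
  intro w
  classical
  rw [← upd2_sup_upd2 z hik hα.le hβ.le, ← upd2_inf_upd2 z hik hα.le hβ.le]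
  set x : κ → X := update (update z i α) k β' with hx
  set y : κ → X := update (update z i α') k β with hy
  -- split off the edge `e`
  set R : (κ → X) → ℝ := fun x => (∏ i, g i (x i)) * ∏ e ∈ E.erase e, b e (x (src e)) (x (tgt e))
    with hR
  have hwBR : ∀ v, w v = b e (v (src e)) (v (tgt e)) * R v := by
    intro v
    simp only [w, hR, ← Finset.mul_prod_erase E (fun e => b e (v (src e)) (v (tgt e))) he]
    ring
  have hR0 : ∀ v, 0 < R v := fun v =>
    mul_pos (Finset.prod_pos fun i _ => hg0 i _) (Finset.prod_pos fun e _ => hb0 e _ _)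
  have hRm : ∀ x y, R x * R y ≤ R (x ⊔ y) * R (x ⊓ y) := by
    have h1 := mtp2_finset_prod (Finset.univ : Finset κ) (fun i x => g i (x i))
      (fun i x => (hg0 i _).le) (fun i x y => mtp2_of_oneBody (g i) i x y)
    have h2 := mtp2_finset_prod (E.erase e) (fun e x => b e (x (src e)) (x (tgt e)))
      (fun e x => (hb0 e _ _).le) (fun e x y => mtp2_of_pairBond (b e) (hb e) (src e) (tgt e) x y)
    exact mtp2_mul (w₁ := fun x => ∏ i, g i (x i))
      (w₂ := fun x => ∏ e ∈ E.erase e, b e (x (src e)) (x (tgt e)))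
      (fun x => Finset.prod_nonneg fun i _ => (hg0 i _).le)
      (fun x => Finset.prod_nonneg fun e _ => (hb0 e _ _).le) h1 h2
  -- the values of the four configurations at `i` and `k`
  have hxi : x i = α := by simp [hx, update_of_ne hik]
  have hxk : x k = β' := by simp [hx]
  have hyi : y i = α' := by simp [hy, update_of_ne hik]
  have hyk : y k = β := by simp [hy]
  have hsi : (x ⊔ y) i = α' := by simp [hxi, hyi, sup_eq_right.2 hα.le]
  have hsk : (x ⊔ y) k = β' := by simp [hxk, hyk, sup_eq_left.2 hβ.le]
  have hii : (x ⊓ y) i = α := by simp [hxi, hyi, inf_eq_left.2 hα.le]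
  have hik' : (x ⊓ y) k = β := by simp [hxk, hyk, inf_eq_right.2 hβ.le]
  have hB : b e (x (src e)) (x (tgt e)) * b e (y (src e)) (y (tgt e)) <
      b e ((x ⊔ y) (src e)) ((x ⊔ y) (tgt e)) * b e ((x ⊓ y) (src e)) ((x ⊓ y) (tgt e)) := by
    rcases hor with ⟨hs, ht⟩ | ⟨hs, ht⟩
    · rw [hs, ht, hxi, hxk, hyi, hyk, hsi, hsk, hii, hik']
      have h := hstrict α α' β β' hα hβ
      linarith [mul_comm (b e α β') (b e α' β), mul_comm (b e α' β') (b e α β)]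
    · rw [hs, ht, hxi, hxk, hyi, hyk, hsi, hsk, hii, hik']
      have h := hstrict β β' α α' hβ hα
      linarith [mul_comm (b e β α) (b e β' α')]
  rw [hwBR x, hwBR y, hwBR (x ⊔ y), hwBR (x ⊓ y)]
  calc b e (x (src e)) (x (tgt e)) * R x * (b e (y (src e)) (y (tgt e)) * R y)
      = (b e (x (src e)) (x (tgt e)) * b e (y (src e)) (y (tgt e))) * (R x * R y) := by ring
    _ < (b e ((x ⊔ y) (src e)) ((x ⊔ y) (tgt e)) * b e ((x ⊓ y) (src e)) ((x ⊓ y) (tgt e))) *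
          (R (x ⊔ y) * R (x ⊓ y)) :=
        mul_lt_mul hB (hRm x y) (mul_pos (hR0 _) (hR0 _))
          (mul_nonneg (hb0 e _ _).le (hb0 e _ _).le)
    _ = _ := by ring

/-- **C5 IN EVERY DIMENSION — THE EXACT AUTOREGRESSIVE CONDITIONAL OF A FERROMAGNET IS STRICTLY TP₂ IN
EVERY SITE CHAINED TO IT THROUGH THE INTEGRATED BLOCK.**  Ferromagnetic pair-interaction weight
`w(x) = ∏_i g_i(x_i)·∏_{e∈E} b_e(x_{src e}, x_{tgt e})` on ANY finite graph (any dimension, any boundary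
condition), positive bounded measurable one-body factors, positive bounded measurable TP₂ bonds, any
reference probability measure that is not a point mass; `s` a block of integrated sites, `a ≠ j`
outside `s` (the current site and a retained one), and a chain `a = c₀, c₁, …, cₙ, cₙ₊₁ = j` with
`c₁, …, cₙ ∈ s` distinct, consecutive sites distinct and joined by an edge of `E` whose bond is
STRICTLY TP₂.  Then `N = A_s w` satisfies, for every configuration `z` and `α < α'`, `β < β'`,
`N(z[a↦α][j↦β'])·N(z[a↦α'][j↦β]) < N(z[a↦α'][j↦β'])·N(z[a↦α][j↦β])`. [ours] -/
theorem pairBondWeight_coordAvg_pureSq_of_chain {η : Type*}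
    (hμ : 0 < (μ.prod μ) {p : X × X | p.1 < p.2}) (E : Finset η) (src tgt : η → κ)
    (b : η → X → X → ℝ) (g : κ → X → ℝ) (hgm : ∀ i, Measurable (g i))
    (hbm : ∀ e, Measurable (uncurry (b e))) (hg0 : ∀ i u, 0 < g i u) (hb0 : ∀ e u v, 0 < b e u v)
    (hgC : ∀ i, ∃ C, ∀ u, g i u ≤ C) (hbC : ∀ e, ∃ C, ∀ u v, b e u v ≤ C)
    (hb : ∀ e u u' v v', u ≤ u' → v ≤ v' → b e u' v * b e u v' ≤ b e u v * b e u' v')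
    (s : Finset κ) {a j : κ} (haj : a ≠ j) (ha : a ∉ s) (hj : j ∉ s) (P : List κ)
    (hP : ∀ c ∈ P, c ∈ s) (hnd : P.Nodup)
    (hchain : List.IsChain (fun i k => i ≠ k ∧ ∃ e ∈ E,
        ((src e = i ∧ tgt e = k) ∨ (src e = k ∧ tgt e = i)) ∧
        ∀ u u' v v', u < u' → v < v' → b e u' v * b e u v' < b e u v * b e u' v') (a :: (P ++ [j]))) :
    let w : (κ → X) → ℝ := fun x => (∏ i, g i (x i)) * ∏ e ∈ E, b e (x (src e)) (x (tgt e))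
    ∀ z (α α' β β' : X), α < α' → β < β' →
      coordAvg μ s w (update (update z a α) j β') * coordAvg μ s w (update (update z a α') j β) <
        coordAvg μ s w (update (update z a α') j β') * coordAvg μ s w (update (update z a α) j β) := by
  intro w
  have hw0 : ∀ x, 0 < w x := fun x =>
    mul_pos (Finset.prod_pos fun i _ => hg0 i _) (Finset.prod_pos fun e _ => hb0 e _ _)
  have hwm : Measurable w :=
    (Finset.measurable_prod _ fun i _ => (hgm i).comp (measurable_pi_apply i)).mul
      (Finset.measurable_prod _ fun e _ =>
        show Measurable (uncurry (b e) ∘ fun x : κ → X => (x (src e), x (tgt e))) from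
          (hbm e).comp ((measurable_pi_apply _).prodMk (measurable_pi_apply _)))
  choose Cg hCg using hgC
  choose Cb hCb using hbC
  have hwC : ∃ C, ∀ x, |w x| ≤ C := by
    refine ⟨(∏ i, Cg i) * ∏ e ∈ E, Cb e, fun x => ?_⟩
    rw [abs_of_nonneg (hw0 x).le]
    exact mul_le_mul (Finset.prod_le_prod (fun i _ => (hg0 i _).le) fun i _ => hCg i _)
      (Finset.prod_le_prod (fun e _ => (hb0 e _ _).le) fun e _ => hCb e _ _)
      (Finset.prod_nonneg fun e _ => (hb0 e _ _).le)
      (Finset.prod_nonneg fun i _ => (hg0 i (x i)).le.trans (hCg i _))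
  have hmtp : ∀ x y, w x * w y ≤ w (x ⊔ y) * w (x ⊓ y) := fun x y =>
    mtp2_pairBondWeight E src tgt b g (fun i u => (hg0 i u).le) (fun e u v => (hb0 e u v).le) hb x y
  refine pureSq_coordAvg_of_chain μ hμ P s hwm hw0 hwC hmtp haj ha hj hP hnd ?_
  refine hchain.imp fun i k hik => ?_
  obtain ⟨hne, e, he, hor, hstrict⟩ := hik
  intro z α α' β β' hα hβ
  exact pureSq_pairBondWeight_of_edge E src tgt b g hg0 hb0 hb hne he hor hstrict z hα hβ

/-! ## §3 The exact conditional reads every retained site chained to it through the block -/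

omit [LinearOrder X] in
/-- **A STRICT SQUARE OF THE PARTIAL AVERAGE IS READ**: for ANY positive bounded measurable weight
`w`, block `s` and sites `a ≠ j`, if `N = A_s w` has ONE strict `(a, j)`-square
(`N(z[a↦α][j↦β'])·N(z[a↦α'][j↦β]) < N(z[a↦α'][j↦β'])·N(z[a↦α][j↦β])`) then there are two
configurations agreeing off `j` with different exact conditionals `A_s w / A_{insert a s} w` (were it
blind to `j`, the ratio would factor through `a` and `j` separately — the normaliser does not read `a`
— forcing equality in the square). [ours] -/
theorem arConditional_reads_of_pureSq_lt (s : Finset κ) {w : (κ → X) → ℝ} (hwm : Measurable w)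
    (hw0 : ∀ x, 0 < w x) (hwC : ∃ C, ∀ x, |w x| ≤ C) {a j : κ} (haj : a ≠ j) (z : κ → X)
    {α α' β β' : X}
    (hlt : coordAvg μ s w (update (update z a α) j β') * coordAvg μ s w (update (update z a α') j β) <
      coordAvg μ s w (update (update z a α') j β') * coordAvg μ s w (update (update z a α) j β)) :
    ∃ ψ ψ' : κ → X, (∀ i, i ≠ j → ψ i = ψ' i) ∧
      coordAvg μ s w ψ / coordAvg μ (insert a s) w ψ ≠
        coordAvg μ s w ψ' / coordAvg μ (insert a s) w ψ' := by
  have hMpos : ∀ ψ, 0 < coordAvg μ (insert a s) w ψ := coordAvg_pos μ (insert a s) hwm hw0 hwC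
  have hMa : ∀ ψ v, coordAvg μ (insert a s) w (update ψ a v) = coordAvg μ (insert a s) w ψ :=
    fun ψ v => coordAvg_update_of_mem μ (insert a s) (Finset.mem_insert_self a s) w ψ v
  by_contra hcon
  push Not at hcon
  -- blindness along `j` at `a ↦ α` and at `a ↦ α'`
  have e1 := hcon (update (update z a α) j β) (update (update z a α) j β')
    (fun i hi => by simp [update_of_ne hi])
  have e2 := hcon (update (update z a α') j β) (update (update z a α') j β')
    (fun i hi => by simp [update_of_ne hi])
  -- the normaliser does not read `a`
  have m1 : coordAvg μ (insert a s) w (update (update z a α') j β) =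
      coordAvg μ (insert a s) w (update (update z a α) j β) := by
    rw [update_comm haj, update_comm haj (f := z), hMa, hMa]
  have m2 : coordAvg μ (insert a s) w (update (update z a α') j β') =
      coordAvg μ (insert a s) w (update (update z a α) j β') := by
    rw [update_comm haj, update_comm haj (f := z), hMa, hMa]
  rw [m1, m2] at e2
  have hM1 := hMpos (update (update z a α) j β)
  have hM2 := hMpos (update (update z a α) j β')
  rw [div_eq_div_iff hM1.ne' hM2.ne'] at e1 e2
  have key : coordAvg μ s w (update (update z a α) j β') *
      coordAvg μ s w (update (update z a α') j β) * (coordAvg μ (insert a s) w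
        (update (update z a α) j β) * coordAvg μ (insert a s) w (update (update z a α) j β')) =
      coordAvg μ s w (update (update z a α') j β') *
        coordAvg μ s w (update (update z a α) j β) * (coordAvg μ (insert a s) w
        (update (update z a α) j β) * coordAvg μ (insert a s) w (update (update z a α) j β')) := by
    linear_combination (coordAvg μ s w (update (update z a α) j β') *
      coordAvg μ (insert a s) w (update (update z a α) j β)) * e2 -
      (coordAvg μ s w (update (update z a α') j β') *
      coordAvg μ (insert a s) w (update (update z a α) j β)) * e1
  exact absurd (mul_right_cancel₀ (mul_pos hM1 hM2).ne' key) (ne_of_lt hlt)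

/-- **HENCE THE EXACT CONDITIONAL OF THE CURRENT SITE READS EVERY RETAINED SITE CHAINED TO IT THROUGH
THE BLOCK** (C5, 'faithful through the integrated block', every dimension): under the hypotheses of
`pairBondWeight_coordAvg_pureSq_of_chain` there are two configurations agreeing off `j` on which the
exact autoregressive conditional `A_s w / A_{insert a s} w` of site `a` differs — an exact sampler
generating `a` with the block `s` still to come must read `j`, however far away, as soon as a chain
of integrated sites joins them. [ours] -/
theorem pairBondWeight_arConditional_reads_of_chain {η : Type*}
    (hμ : 0 < (μ.prod μ) {p : X × X | p.1 < p.2}) (E : Finset η) (src tgt : η → κ)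
    (b : η → X → X → ℝ) (g : κ → X → ℝ) (hgm : ∀ i, Measurable (g i))
    (hbm : ∀ e, Measurable (uncurry (b e))) (hg0 : ∀ i u, 0 < g i u) (hb0 : ∀ e u v, 0 < b e u v)
    (hgC : ∀ i, ∃ C, ∀ u, g i u ≤ C) (hbC : ∀ e, ∃ C, ∀ u v, b e u v ≤ C)
    (hb : ∀ e u u' v v', u ≤ u' → v ≤ v' → b e u' v * b e u v' ≤ b e u v * b e u' v')
    (s : Finset κ) {a j : κ} (haj : a ≠ j) (ha : a ∉ s) (hj : j ∉ s) (P : List κ)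
    (hP : ∀ c ∈ P, c ∈ s) (hnd : P.Nodup)
    (hchain : List.IsChain (fun i k => i ≠ k ∧ ∃ e ∈ E,
        ((src e = i ∧ tgt e = k) ∨ (src e = k ∧ tgt e = i)) ∧
        ∀ u u' v v', u < u' → v < v' → b e u' v * b e u v' < b e u v * b e u' v') (a :: (P ++ [j]))) :
    let w : (κ → X) → ℝ := fun x => (∏ i, g i (x i)) * ∏ e ∈ E, b e (x (src e)) (x (tgt e))
    ∃ ψ ψ' : κ → X, (∀ i, i ≠ j → ψ i = ψ' i) ∧
      coordAvg μ s w ψ / coordAvg μ (insert a s) w ψ ≠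
        coordAvg μ s w ψ' / coordAvg μ (insert a s) w ψ' := by
  intro w
  obtain ⟨q, hq⟩ := nonempty_of_measure_ne_zero (ne_of_gt hμ)
  have hq' : q.1 < q.2 := hq
  have hw0 : ∀ x, 0 < w x := fun x =>
    mul_pos (Finset.prod_pos fun i _ => hg0 i _) (Finset.prod_pos fun e _ => hb0 e _ _)
  have hwm : Measurable w :=
    (Finset.measurable_prod _ fun i _ => (hgm i).comp (measurable_pi_apply i)).mul
      (Finset.measurable_prod _ fun e _ =>
        show Measurable (uncurry (b e) ∘ fun x : κ → X => (x (src e), x (tgt e))) from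
          (hbm e).comp ((measurable_pi_apply _).prodMk (measurable_pi_apply _)))
  choose Cg hCg using hgC
  choose Cb hCb using hbC
  have hwC : ∃ C, ∀ x, |w x| ≤ C := by
    refine ⟨(∏ i, Cg i) * ∏ e ∈ E, Cb e, fun x => ?_⟩
    rw [abs_of_nonneg (hw0 x).le]
    exact mul_le_mul (Finset.prod_le_prod (fun i _ => (hg0 i _).le) fun i _ => hCg i _)
      (Finset.prod_le_prod (fun e _ => (hb0 e _ _).le) fun e _ => hCb e _ _)
      (Finset.prod_nonneg fun e _ => (hb0 e _ _).le)
      (Finset.prod_nonneg fun i _ => (hg0 i (x i)).le.trans (hCg i _))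
  exact arConditional_reads_of_pureSq_lt μ s hwm hw0 hwC haj (fun _ => q.1)
    (pairBondWeight_coordAvg_pureSq_of_chain μ hμ E src tgt b g hgm hbm hg0 hb0 (fun i => ⟨Cg i, hCg i⟩)
      (fun e => ⟨Cb e, hCb e⟩) hb s haj ha hj P hP hnd hchain (fun _ => q.1) q.1 q.2 q.1 q.2 hq' hq')

end PairBond

/-! ## §4 The lower half of the context bracket: every frontier vertex is read -/

section Frontier

open Literature.Combinatorics.SimpleGraph Literature.LinearAlgebra.Matrix.ChordalSparsity

variable {V : Type*} [Fintype V] [LinearOrder V] [DecidableEq V] (μ : Measure X)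
  [IsProbabilityMeasure μ]

omit [DecidableEq V] in
/-- **A frontier vertex is the end of an integrated chain**: for `v ∈ outer G (lowerComp G a)` there is
a duplicate-free list `P` of vertices `< a` with `a, P, v` consecutively `G`-adjacent, and `a < v`
(a walk inside the lower component from `a` to a neighbour of `v`, made simple by `Walk.bypass`).
[ours] -/
theorem exists_chain_of_mem_outer (G : SimpleGraph V) (a : V) {v : V}
    (hv : v ∈ outer G (lowerComp G a)) :
    ∃ P : List V, (∀ c ∈ P, c ∈ Finset.univ.filter (· < a)) ∧ P.Nodup ∧
      List.IsChain G.Adj (a :: (P ++ [v])) ∧ a < v := by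
  obtain ⟨hvK, u, hu, huv⟩ := hv
  obtain ⟨p, hp⟩ := hu
  have hav : a < v := by
    by_contra h
    exact hvK (mem_lowerComp_of_adj ⟨p, hp⟩ huv (not_lt.1 h))
  have hqsupp : ∀ z ∈ p.bypass.support, z ≤ a := fun z hz =>
    hp z (p.support_bypass_subset_support hz)
  have hcons : a :: p.bypass.support.tail = p.bypass.support := p.bypass.cons_tail_support
  have hnodup : (a :: p.bypass.support.tail).Nodup := by
    rw [hcons]; exact (SimpleGraph.Walk.isPath_def _).1 p.bypass_isPath
  have haP : a ∉ p.bypass.support.tail := (List.nodup_cons.1 hnodup).1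
  refine ⟨p.bypass.support.tail, fun c hc => ?_, (List.nodup_cons.1 hnodup).2, ?_, hav⟩
  · have hca : c ≤ a := hqsupp c (by rw [← hcons]; exact List.mem_cons_of_mem a hc)
    have hne : c ≠ a := fun h => haP (h ▸ hc)
    simp [lt_of_le_of_ne hca hne]
  · have h := (p.bypass.concat huv).isChain_adj_support
    rw [SimpleGraph.Walk.support_concat, ← hcons, List.cons_append] at h
    exact h

/-- **THE EXACT CONDITIONAL READS EVERY VERTEX OF THE OUTER BOUNDARY OF ITS LOWER COMPONENT** (lower
half of the context bracket; the upper half is `Scaling/AutoregressiveMarkovContext.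
arConditional_congr_of_frontier`): ferromagnetic pair interaction on the graph `G` — positive bounded
measurable one-body factors, every edge of `G` carried by a term of `E` with a positive bounded
measurable STRICTLY TP₂ bond (all bonds TP₂), reference probability measure not a point mass; order the
vertices linearly and integrate `s = {u | u < a}` (generation from the top).  Then for every
`v ∈ outer G (lowerComp G a)` there are two configurations agreeing off `v` with different exact
conditionals `A_s w / A_{insert a s} w` of `a`. [ours] -/
theorem pairBondWeight_arConditional_reads_outer {η : Type*}
    (hμ : 0 < (μ.prod μ) {p : X × X | p.1 < p.2}) (G : SimpleGraph V) (E : Finset η)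
    (src tgt : η → V) (b : η → X → X → ℝ) (g : V → X → ℝ) (hgm : ∀ i, Measurable (g i))
    (hbm : ∀ e, Measurable (uncurry (b e))) (hg0 : ∀ i u, 0 < g i u) (hb0 : ∀ e u v, 0 < b e u v)
    (hgC : ∀ i, ∃ C, ∀ u, g i u ≤ C) (hbC : ∀ e, ∃ C, ∀ u v, b e u v ≤ C)
    (hb : ∀ e u u' v v', u ≤ u' → v ≤ v' → b e u' v * b e u v' ≤ b e u v * b e u' v')
    (hE : ∀ i k, G.Adj i k → ∃ e ∈ E, ((src e = i ∧ tgt e = k) ∨ (src e = k ∧ tgt e = i)) ∧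
        ∀ u u' v v', u < u' → v < v' → b e u' v * b e u v' < b e u v * b e u' v')
    (a : V) {v : V} (hv : v ∈ outer G (lowerComp G a)) :
    let w : (V → X) → ℝ := fun x => (∏ i, g i (x i)) * ∏ e ∈ E, b e (x (src e)) (x (tgt e))
    ∃ ψ ψ' : V → X, (∀ i, i ≠ v → ψ i = ψ' i) ∧
      coordAvg μ (Finset.univ.filter (· < a)) w ψ /
          coordAvg μ (insert a (Finset.univ.filter (· < a))) w ψ ≠
        coordAvg μ (Finset.univ.filter (· < a)) w ψ' /
          coordAvg μ (insert a (Finset.univ.filter (· < a))) w ψ' := by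
  intro w
  obtain ⟨P, hPs, hPnd, hchainG, hav⟩ := exists_chain_of_mem_outer G a hv
  refine pairBondWeight_arConditional_reads_of_chain μ hμ E src tgt b g hgm hbm hg0 hb0 hgC hbC hb
    (Finset.univ.filter (· < a)) (ne_of_lt hav) (by simp) (by simp [not_lt.2 hav.le]) P hPs hPnd ?_
  exact hchainG.imp fun i k hik => ⟨hik.ne, hE i k hik⟩

/-- **… EQUIVALENTLY, EVERY VERTEX OF THE HIGHER FILL-NEIGHBOURHOOD `adj⁺(a)` OF THE ELIMINATION GRAPH
IS READ** (`higherAdj_elimGraph_eq_outer_lowerComp`).  With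
`AutoregressiveMarkovContext.arConditional_congr_of_higherAdj` (nothing else is read) this pins the
context of the exact autoregressive conditional of a ferromagnet down EXACTLY: the fill-neighbourhood,
no less (this file) and no more (GEN-15) — T2-AF's triangular-footprint bracket is an equality for
strictly TP₂ pair interactions. [ours] -/
theorem pairBondWeight_arConditional_reads_higherAdj {η : Type*}
    (hμ : 0 < (μ.prod μ) {p : X × X | p.1 < p.2}) (G : SimpleGraph V) (E : Finset η)
    (src tgt : η → V) (b : η → X → X → ℝ) (g : V → X → ℝ) (hgm : ∀ i, Measurable (g i))
    (hbm : ∀ e, Measurable (uncurry (b e))) (hg0 : ∀ i u, 0 < g i u) (hb0 : ∀ e u v, 0 < b e u v)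
    (hgC : ∀ i, ∃ C, ∀ u, g i u ≤ C) (hbC : ∀ e, ∃ C, ∀ u v, b e u v ≤ C)
    (hb : ∀ e u u' v v', u ≤ u' → v ≤ v' → b e u' v * b e u v' ≤ b e u v * b e u' v')
    (hE : ∀ i k, G.Adj i k → ∃ e ∈ E, ((src e = i ∧ tgt e = k) ∨ (src e = k ∧ tgt e = i)) ∧
        ∀ u u' v v', u < u' → v < v' → b e u' v * b e u v' < b e u v * b e u' v')
    (a : V) {v : V} (hv : v ∈ higherAdj (elimGraph G).Adj a) :
    let w : (V → X) → ℝ := fun x => (∏ i, g i (x i)) * ∏ e ∈ E, b e (x (src e)) (x (tgt e))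
    ∃ ψ ψ' : V → X, (∀ i, i ≠ v → ψ i = ψ' i) ∧
      coordAvg μ (Finset.univ.filter (· < a)) w ψ /
          coordAvg μ (insert a (Finset.univ.filter (· < a))) w ψ ≠
        coordAvg μ (Finset.univ.filter (· < a)) w ψ' /
          coordAvg μ (insert a (Finset.univ.filter (· < a))) w ψ' := by
  rw [higherAdj_elimGraph_eq_outer_lowerComp] at hv
  exact pairBondWeight_arConditional_reads_outer μ hμ G E src tgt b g hgm hbm hg0 hb0 hgC hbC hb hE
    a hv

end Frontier

end Summit.Ventures.LatticeQCDFlow.Theory2.Autoregressive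

end
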